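import Mathlib
import Summits.KontsevichZagierPeriods.Zeta5Search.RhinViolaTheta
import Literature.NumberTheory.Automorphic.GodementJacquetCenterMellin
import HarnessLib

/-!
# ζ(5) search — Rhin–Viola's `ϑ` on the Beukers-type triple integrals with COMPLEX exponents (cell `pub-zeta5`, seat ct-1 g12)

HONEST FRAMING: systematic search; no irrationality claim unless kernel-certified. Nothing in this file is an
irrationality result, a worthiness exponent or a denominator statement. `RhinViolaTheta.lean` gives Rhin–Viola's
birational change of variables `ϑ` of `(0,1)³` [G. Rhin, C. Viola, *The group structure for ζ(3)*, Acta Arith. 97 (2001),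
§2] and its action on `∫ x^h(1−x)^l y^k(1−y)^s z^j(1−z)^q (1−(1−xy)z)^{−c}` for INTEGER exponents. The Bailey-free route to
Brown–Zudilin's generators `h, h'` [BrownZudilin2022, Sect. 7] (memo `ct-1/g12/EULERSYM.md` §3) needs the same with COMPLEX
exponents on the positive real atoms (after Mellin-decoupling the `t`-side the `z`-exponents are `p₃+1+t`, `q₃−p₆−1−t`).
Here:

* `integral_comp_rvTheta'` — the change of variables for integrands with values in any real normed space (`ℂ` in particular);
* `rv_integrand_theta_cpow` — the transformation rule of the integrand with complex exponents `h,l,k,s,j,q,c` on the open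
  cube, under RV's constraint `j + q = l + s` (2.3): principal powers of positive reals, compared through `exp ∘ log`
  (`Literature.NumberTheory.Automorphic.ofReal_cpow_eq_exp`, reused);
* **`rv_theta_invariance_cpow`** — `∫ x^h(1−x)^l y^k(1−y)^s z^j(1−z)^q L^{−c} = ∫ x^s(1−x)^k y^j(1−y)^{h+q+1−c} z^h(1−z)^{k+q+1−c}
  L^{−(k+s+2−c)}` over `(0,1)³` for ALL complex exponents with `j + q = l + s` (Bochner integrals in `ℂ`; no convergence
  hypothesis — both sides junk `0` together);
* `setIntegral_cube3_perm'`, `rv_sigma_cpow` — coordinate permutations of the cube for vector-valued integrands and RV's `σ`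
  (`x ↔ y`) with complex exponents.

Theorems only (no new definitions).
-/

noncomputable section

namespace Summit.KontsevichZagierPeriods.Zeta5Search.RhinViolaThetaComplex

open MeasureTheory Set Filter
open Summit.KontsevichZagierPeriods.Zeta5Search.RhinViolaTheta
open Literature.NumberTheory.Automorphic (ofReal_cpow_eq_exp)

/-- **Change of variables by `ϑ` for vector-valued integrands**: for every `g` with values in a real normed space,
`∫_{(0,1)³} g = ∫_{(0,1)³} (1−x₁)(1−x₂)/L(x)² • g(ϑ x) dx`. [RV (2.5)–(2.6)] -/
theorem integral_comp_rvTheta' {E : Type*} [NormedAddCommGroup E] [NormedSpace ℝ E] (g : (Fin 3 → ℝ) → E) :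
    ∫ X in (univ.pi fun _ : Fin 3 => Ioo (0:ℝ) 1), g X =
      ∫ x in (univ.pi fun _ : Fin 3 => Ioo (0:ℝ) 1), ((1 - x 1) * (1 - x 2) / (1 - (1 - x 0 * x 1) * x 2) ^ 2) •
        g ![(1 - x 1) * x 2, (1 - x 0) * (1 - x 2) / (1 - (1 - x 0 * x 1) * x 2), x 1 / (1 - (1 - x 1) * x 2)] := by
  have hex : ∀ x : Fin 3 → ℝ, ∃ f' : (Fin 3 → ℝ) →L[ℝ] (Fin 3 → ℝ), x ∈ (univ.pi fun _ : Fin 3 => Ioo (0:ℝ) 1) →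
      HasFDerivAt (fun x : Fin 3 → ℝ => (![(1 - x 1) * x 2, (1 - x 0) * (1 - x 2) / (1 - (1 - x 0 * x 1) * x 2),
        x 1 / (1 - (1 - x 1) * x 2)] : Fin 3 → ℝ)) f' x ∧
      f'.det = -((1 - x 1) * (1 - x 2)) / (1 - (1 - x 0 * x 1) * x 2) ^ 2 := by
    intro x
    by_cases hx : x ∈ (univ.pi fun _ : Fin 3 => Ioo (0:ℝ) 1)
    · obtain ⟨hL, hN, -⟩ := cube3_aux (mem_cube3 hx 0) (mem_cube3 hx 1) (mem_cube3 hx 2)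
      obtain ⟨f', hf'⟩ := hasFDerivAt_rvTheta x hL.ne' hN.ne'
      exact ⟨f', fun _ => hf'⟩
    · exact ⟨0, fun h => (hx h).elim⟩
  choose f' hf' using hex
  have hderiv : ∀ x ∈ (univ.pi fun _ : Fin 3 => Ioo (0:ℝ) 1), HasFDerivWithinAt
      (fun x : Fin 3 → ℝ => (![(1 - x 1) * x 2, (1 - x 0) * (1 - x 2) / (1 - (1 - x 0 * x 1) * x 2),
        x 1 / (1 - (1 - x 1) * x 2)] : Fin 3 → ℝ)) (f' x) (univ.pi fun _ : Fin 3 => Ioo (0:ℝ) 1) x :=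
    fun x hx => (hf' x hx).1.hasFDerivWithinAt
  have hcv := integral_image_eq_integral_abs_det_fderiv_smul volume measurableSet_cube3 hderiv rvTheta_injOn g
  rw [rvTheta_image] at hcv
  rw [hcv]
  refine setIntegral_congr_fun measurableSet_cube3 fun x hx => ?_
  have h1 := mem_cube3 hx 1; have h2 := mem_cube3 hx 2
  obtain ⟨hL, -⟩ := cube3_aux (mem_cube3 hx 0) h1 h2
  rw [(hf' x hx).2, neg_div, abs_neg,
    abs_of_pos (div_pos (mul_pos (by linarith [h1.2]) (by linarith [h2.2])) (pow_pos hL 2))]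

/-- A positive real as an exponential: `(a : ℂ) = exp(log a)`. -/
theorem ofReal_eq_exp_log {a : ℝ} (ha : 0 < a) : (a : ℂ) = Complex.exp (Real.log a : ℂ) := by
  rw [← Complex.ofReal_exp, Real.exp_log ha]

/-- **Pointwise, complex exponents**: for `0 < x₀,x₁,x₂ < 1` and complex `h,l,k,s,j,q,c` with `j + q = l + s`,
`(1−x₁)(1−x₂)/L² · [X^h(1−X)^l Y^k(1−Y)^s Z^j(1−Z)^q L(X,Y,Z)^{−c}] = x₀^s(1−x₀)^k x₁^j(1−x₁)^{h+q+1−c} x₂^h(1−x₂)^{k+q+1−c} L^{−(k+s+2−c)}`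
where `(X,Y,Z) = ϑ(x₀,x₁,x₂)` and all powers are principal powers of positive reals. [RV (2.5)] -/
theorem rv_integrand_theta_cpow (h l k s j q c : ℂ) (hjq : j + q = l + s) {x0 x1 x2 : ℝ} (h0 : 0 < x0 ∧ x0 < 1)
    (h1 : 0 < x1 ∧ x1 < 1) (h2 : 0 < x2 ∧ x2 < 1) :
    (((1 - x1) * (1 - x2) / (1 - (1 - x0 * x1) * x2) ^ 2 : ℝ) : ℂ) *
        ((((1 - x1) * x2 : ℝ) : ℂ) ^ h * ((1 - (1 - x1) * x2 : ℝ) : ℂ) ^ l *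
          (((1 - x0) * (1 - x2) / (1 - (1 - x0 * x1) * x2) : ℝ) : ℂ) ^ k *
          ((1 - (1 - x0) * (1 - x2) / (1 - (1 - x0 * x1) * x2) : ℝ) : ℂ) ^ s *
          ((x1 / (1 - (1 - x1) * x2) : ℝ) : ℂ) ^ j * ((1 - x1 / (1 - (1 - x1) * x2) : ℝ) : ℂ) ^ q /
          ((1 - (1 - (1 - x1) * x2 * ((1 - x0) * (1 - x2) / (1 - (1 - x0 * x1) * x2))) * (x1 / (1 - (1 - x1) * x2)) :
            ℝ) : ℂ) ^ c) =
      ((x0 : ℝ) : ℂ) ^ s * ((1 - x0 : ℝ) : ℂ) ^ k * ((x1 : ℝ) : ℂ) ^ j * ((1 - x1 : ℝ) : ℂ) ^ (h + q + 1 - c) *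
        ((x2 : ℝ) : ℂ) ^ h * ((1 - x2 : ℝ) : ℂ) ^ (k + q + 1 - c) /
        ((1 - (1 - x0 * x1) * x2 : ℝ) : ℂ) ^ (k + s + 2 - c) := by
  obtain ⟨hL, hN, hYlt, hZlt, hX0, hX1⟩ := cube3_aux h0 h1 h2
  obtain ⟨eY, eZ, eLn⟩ := rvTheta_atoms hL.ne' hN.ne'
  rw [eY, eZ, eLn]
  have u0 : 0 < 1 - x0 := by linarith [h0.2]
  have u1 : 0 < 1 - x1 := by linarith [h1.2]
  have u2 : 0 < 1 - x2 := by linarith [h2.2]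
  -- positivity of the atoms after `ϑ`
  have pX : 0 < (1 - x1) * x2 := hX0
  have pY : 0 < (1 - x0) * (1 - x2) / (1 - (1 - x0 * x1) * x2) := div_pos (mul_pos u0 u2) hL
  have pY' : 0 < x0 * (1 - (1 - x1) * x2) / (1 - (1 - x0 * x1) * x2) := div_pos (mul_pos h0.1 hN) hL
  have pZ : 0 < x1 / (1 - (1 - x1) * x2) := div_pos h1.1 hN
  have pZ' : 0 < (1 - x1) * (1 - x2) / (1 - (1 - x1) * x2) := div_pos (mul_pos u1 u2) hN
  have pLn : 0 < (1 - x1) * (1 - x2) / (1 - (1 - x0 * x1) * x2) := div_pos (mul_pos u1 u2) hL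
  have pJ : 0 < (1 - x1) * (1 - x2) / (1 - (1 - x0 * x1) * x2) ^ 2 := div_pos (mul_pos u1 u2) (pow_pos hL 2)
  rw [ofReal_cpow_eq_exp pX, ofReal_cpow_eq_exp hN, ofReal_cpow_eq_exp pY, ofReal_cpow_eq_exp pY', ofReal_cpow_eq_exp pZ,
    ofReal_cpow_eq_exp pZ', ofReal_cpow_eq_exp pLn, ofReal_cpow_eq_exp h0.1, ofReal_cpow_eq_exp u0, ofReal_cpow_eq_exp h1.1,
    ofReal_cpow_eq_exp u1, ofReal_cpow_eq_exp h2.1, ofReal_cpow_eq_exp u2, ofReal_cpow_eq_exp hL, ofReal_eq_exp_log pJ]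
  rw [Real.log_div (mul_pos u1 u2).ne' (pow_pos hL 2).ne', Real.log_pow,
    Real.log_mul u1.ne' h2.1.ne', Real.log_div (mul_pos u0 u2).ne' hL.ne', Real.log_mul u0.ne' u2.ne',
    Real.log_div (mul_pos h0.1 hN).ne' hL.ne', Real.log_mul h0.1.ne' hN.ne', Real.log_div h1.1.ne' hN.ne',
    Real.log_div (mul_pos u1 u2).ne' hN.ne', Real.log_div (mul_pos u1 u2).ne' hL.ne', Real.log_mul u1.ne' u2.ne']
  simp only [← Complex.exp_add, ← Complex.exp_sub]
  congr 1
  push_cast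
  linear_combination (-(Real.log (1 - (1 - x1) * x2) : ℂ)) * hjq

/-- **Rhin–Viola's `ϑ`-invariance with complex exponents**: for complex `h,l,k,s,j,q,c` with `j + q = l + s`,
`∫_{(0,1)³} x^h(1−x)^l y^k(1−y)^s z^j(1−z)^q L^{−c} = ∫_{(0,1)³} x^s(1−x)^k y^j(1−y)^{h+q+1−c} z^h(1−z)^{k+q+1−c} L^{−(k+s+2−c)}`
(principal powers of the positive real atoms; Bochner integrals in `ℂ`, both sides junk `0` together). [RV (2.4)–(2.6)] -/
theorem rv_theta_invariance_cpow (h l k s j q c : ℂ) (hjq : j + q = l + s) :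
    ∫ x in (univ.pi fun _ : Fin 3 => Ioo (0:ℝ) 1),
        ((x 0 : ℝ) : ℂ) ^ h * ((1 - x 0 : ℝ) : ℂ) ^ l * ((x 1 : ℝ) : ℂ) ^ k * ((1 - x 1 : ℝ) : ℂ) ^ s *
          ((x 2 : ℝ) : ℂ) ^ j * ((1 - x 2 : ℝ) : ℂ) ^ q / ((1 - (1 - x 0 * x 1) * x 2 : ℝ) : ℂ) ^ c =
      ∫ x in (univ.pi fun _ : Fin 3 => Ioo (0:ℝ) 1),
        ((x 0 : ℝ) : ℂ) ^ s * ((1 - x 0 : ℝ) : ℂ) ^ k * ((x 1 : ℝ) : ℂ) ^ j * ((1 - x 1 : ℝ) : ℂ) ^ (h + q + 1 - c) *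
          ((x 2 : ℝ) : ℂ) ^ h * ((1 - x 2 : ℝ) : ℂ) ^ (k + q + 1 - c) /
          ((1 - (1 - x 0 * x 1) * x 2 : ℝ) : ℂ) ^ (k + s + 2 - c) := by
  rw [integral_comp_rvTheta']
  refine setIntegral_congr_fun measurableSet_cube3 fun x hx => ?_
  simp only [Matrix.cons_val_zero, Matrix.cons_val_one, Matrix.cons_val, Complex.real_smul]
  exact rv_integrand_theta_cpow h l k s j q c hjq (mem_cube3 hx 0) (mem_cube3 hx 1) (mem_cube3 hx 2)

/-! ### `σ` with complex exponents (coordinate permutations for vector-valued integrands) -/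

/-- Coordinate permutations of the cube for vector-valued integrands: `∫_{(0,1)³} g(x ∘ σ) = ∫_{(0,1)³} g`. -/
theorem setIntegral_cube3_perm' {E : Type*} [NormedAddCommGroup E] [NormedSpace ℝ E] (σ : Equiv.Perm (Fin 3))
    (g : (Fin 3 → ℝ) → E) :
    ∫ x in (univ.pi fun _ : Fin 3 => Ioo (0:ℝ) 1), g (fun i => x (σ i)) =
      ∫ x in (univ.pi fun _ : Fin 3 => Ioo (0:ℝ) 1), g x := by
  let e : (Fin 3 → ℝ) ≃ᵐ (Fin 3 → ℝ) := MeasurableEquiv.piCongrLeft (fun _ : Fin 3 => ℝ) σ.symm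
  have he : ∀ x : Fin 3 → ℝ, (e x : Fin 3 → ℝ) = fun i => x (σ i) := by
    intro x; ext i
    simp [e, MeasurableEquiv.coe_piCongrLeft, Equiv.piCongrLeft_apply_eq_cast]
  have hmp : MeasurePreserving e volume volume := volume_measurePreserving_piCongrLeft (fun _ : Fin 3 => ℝ) σ.symm
  have hpre : e ⁻¹' (univ.pi fun _ : Fin 3 => Ioo (0:ℝ) 1) = (univ.pi fun _ : Fin 3 => Ioo (0:ℝ) 1) := by
    ext x
    simp only [Set.mem_preimage, he, mem_univ_pi]
    exact ⟨fun h i => by simpa using h (σ.symm i), fun h i => h (σ i)⟩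
  have key := hmp.setIntegral_preimage_emb e.measurableEmbedding g (univ.pi fun _ : Fin 3 => Ioo (0:ℝ) 1)
  rw [hpre] at key
  simpa only [he] using key

/-- **Rhin–Viola's `σ` with complex exponents**: the swap `x ↔ y`,
`∫ x^h(1−x)^l y^k(1−y)^s z^j(1−z)^q L^{−c} = ∫ x^k(1−x)^s y^h(1−y)^l z^j(1−z)^q L^{−c}`. [RV §2] -/
theorem rv_sigma_cpow (h l k s j q c : ℂ) :
    ∫ x in (univ.pi fun _ : Fin 3 => Ioo (0:ℝ) 1),
        ((x 0 : ℝ) : ℂ) ^ h * ((1 - x 0 : ℝ) : ℂ) ^ l * ((x 1 : ℝ) : ℂ) ^ k * ((1 - x 1 : ℝ) : ℂ) ^ s *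
          ((x 2 : ℝ) : ℂ) ^ j * ((1 - x 2 : ℝ) : ℂ) ^ q / ((1 - (1 - x 0 * x 1) * x 2 : ℝ) : ℂ) ^ c =
      ∫ x in (univ.pi fun _ : Fin 3 => Ioo (0:ℝ) 1),
        ((x 0 : ℝ) : ℂ) ^ k * ((1 - x 0 : ℝ) : ℂ) ^ s * ((x 1 : ℝ) : ℂ) ^ h * ((1 - x 1 : ℝ) : ℂ) ^ l *
          ((x 2 : ℝ) : ℂ) ^ j * ((1 - x 2 : ℝ) : ℂ) ^ q / ((1 - (1 - x 0 * x 1) * x 2 : ℝ) : ℂ) ^ c := by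
  rw [← setIntegral_cube3_perm' (Equiv.swap 0 1)]
  refine setIntegral_congr_fun measurableSet_cube3 fun x _ => ?_
  simp only [Equiv.swap_apply_left, Equiv.swap_apply_right,
    show Equiv.swap (0 : Fin 3) 1 2 = 2 from by decide]
  rw [mul_comm (x 1) (x 0)]
  ring

end Summit.KontsevichZagierPeriods.Zeta5Search.RhinViolaThetaComplex

end
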